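import Literature.NumberTheory.EllipticCurves.TwoDescentQuadraticTwistSquarePlace
import Literature.NumberTheory.EllipticCurves.TwoDescentKummerBridgeRat
import HarnessLib

/-!
# Complete `2`-descent on a quadratic twist, II: the twisting primes, torsion normalisation, and the real
# place for a negative twist

Continuation of `TwoDescentQuadraticTwistSquarePlace.lean`. Let `E/ℚ` have rational `2`-torsion `e₁, e₂, e₃`
(`SplitTwoTorsion`), `d ∈ ℚˣ`, and `E^{(d)} = quadraticTwist E d : y² = (x - d e₁)(x - d e₂)(x - d e₃)`.

* §1 **Components of a sum.** The component pair `([a], [b]) ∈ (Kˣ/Kˣ²)²` of a class of `H¹(K, E[2])`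
  (`kummerEquiv ∘ H¹(χᵢ)`, `TwoDescentTwoTorsionCharacter.lean`) is additive: `c + c'` has components
  `([a a'], [b b'])` (`kummerEquiv_twoTorsionCharH1_add`).
* §2 **A twisting prime is a place of type `I₀*` for the twist.** At an odd prime `q` with `v_q(d) = 1` at which
  the three root differences of `E` are `q`-units, the roots `d eᵢ` of `E^{(d)}` have all differences of valuation
  `1`, so the `I₀*` relations of `TwoDescentKummerBridgeAdditivePlace.qrBit_eq_of_mem_selmerGroup_of_add` hold for
  every `c ∈ Sel⁽²⁾(E^{(d)}/ℚ)` with components `([a], [b])`: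
  `qr_q(a) = v_q(a)·(qr_q(d) + qr_q(e₂ - e₁)) + v_q(b)·qr_q((e₁ - e₂)(e₁ - e₃))`,
  `qr_q(b) = v_q(a)·qr_q((e₂ - e₁)(e₂ - e₃)) + v_q(b)·(qr_q(d) + qr_q(e₁ - e₂))` (bits in `ℤ/2`;
  `qrBit_rel_quadraticTwist_of_mem_selmerGroup`); in particular a Selmer class whose components have EVEN
  valuation at `q` has both components `q`-adic squares (`qrBit_eq_zero_quadraticTwist_of_parityBit_eq_zero`).
* §3 **Torsion normalisation at a twisting prime.** The four torsion pairs `(1,1)`,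
  `(d²(e₁-e₂)(e₁-e₃), d(e₁-e₂))`, `(d(e₂-e₁), d²(e₂-e₁)(e₂-e₃))`, `(d(e₃-e₁), d(e₃-e₂))` of `E^{(d)}` have
  `q`-parities `(0,0), (0,1), (1,0), (1,1)`: for every pair `(a, b)` one of them, `(t₁, t₂)`, has
  `v_q(a t₁)`, `v_q(b t₂)` even, and its class `c(t₁, t₂)` is Selmer (`exists_torsionPair_quadraticTwist_parityBit_mul_eq_zero`).
* §4 **The real place when the roots DECREASE** (`e₁ > e₂ > e₃`, the shape of a twist by `d < 0` of a curve with
  `e₁ < e₂ < e₃`): the two components of a Selmer class have the SAME sign, `0 < a b`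
  (`mul_pos_of_mem_selmerGroup_of_gt`): on `y² = ∏ (x - eᵢ)` no real point has `e₂ < x < e₁`.

Silverman, *AEC*, Prop. X.1.4 / X.4.9; for the role of these local conditions in the `2`-descent on twists:
Kramer 1981, Prop. 1–3 and Thm. 1; Mazur–Rubin 2010, Lemma 2.10/2.11 (the local condition at a twisting prime is
the image of the `2`-torsion). Theorems only; no named fact. Cell `bsd-f1-sign2` (LEAD gk2-p1), toward LINE 49
stub D0≤2 (crux R″ `RankOneTwoTorsionResidualAtTwo`).

## References

* [SilvermanAEC2009] J. H. Silverman, *The Arithmetic of Elliptic Curves*, 2nd ed., GTM 106, Springer 2009,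
  Prop. X.1.4, Example X.1.5, Prop. X.4.9.
* [Kramer1981] K. Kramer, *Arithmetic of elliptic curves upon quadratic extension*, Trans. AMS 264 (1981)
  121–135, Props. 1–3, Thm. 1.
* [MazurRubin2010] B. Mazur, K. Rubin, *Ranks of twists of elliptic curves and Hilbert's tenth problem*,
  Invent. Math. 181 (2010), Lemma 2.10, Lemma 2.11.
-/

noncomputable section

open scoped Classical

universe u

namespace WeierstrassCurve

open Literature.NumberTheory.GaloisRepresentations Literature.NumberTheory.EllipticCurves Field
open WeierstrassCurve.Affine WeierstrassCurve.Affine.Point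
open Literature.NumberTheory.EllipticCurves.TwoDescentLocal
open Literature.NumberTheory.EllipticCurves.KramerTwoDescent
open IsDedekindDomain NumberField Rat.HeightOneSpectrum

/-! ## §1 Components of a sum -/

section Components

variable {K : Type u} [Field K] [CharZero K] (W : WeierstrassCurve K) [W.IsElliptic] {e₁ e₂ e₃ : K}

/-- **The `T₁`-component is additive**: if `c`, `c'` have `T₁`-components `[a]`, `[a']` then `c + c'` has
`T₁`-component `[a a']` (`H¹(χ₁)` and Kummer theory are homomorphisms). [cite: SilvermanAEC2009, Thm. X.1.1, Prop. X.1.4] -/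
theorem kummerEquiv_twoTorsionCharH1_add (h : W.toAffine.SplitTwoTorsion e₁ e₂ e₃) {c c' : galH1Torsion W 2}
    (a a' : Kˣ) (ha : kummerEquiv K 2 (W.twoTorsionCharH1 h c) = Additive.ofMul (QuotientGroup.mk a))
    (ha' : kummerEquiv K 2 (W.twoTorsionCharH1 h c') = Additive.ofMul (QuotientGroup.mk a')) :
    kummerEquiv K 2 (W.twoTorsionCharH1 h (c + c')) = Additive.ofMul (QuotientGroup.mk (a * a')) := by
  rw [map_add, map_add, ha, ha', ← ofMul_mul, ← QuotientGroup.mk_mul]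

/-- **Every class has a component pair**: representatives `a, b ∈ Kˣ` of the two components of `c`.
[cite: SilvermanAEC2009, Prop. X.1.4] -/
theorem exists_kummerEquiv_twoTorsionCharH1_pair_eq (h : W.toAffine.SplitTwoTorsion e₁ e₂ e₃) (c : galH1Torsion W 2) :
    ∃ a b : Kˣ, kummerEquiv K 2 (W.twoTorsionCharH1 h c) = Additive.ofMul (QuotientGroup.mk a) ∧
      kummerEquiv K 2 (W.twoTorsionCharH1 h.swap₁₂ c) = Additive.ofMul (QuotientGroup.mk b) := by
  obtain ⟨a, ha⟩ := QuotientGroup.mk_surjective (Additive.toMul (kummerEquiv K 2 (W.twoTorsionCharH1 h c)))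
  obtain ⟨b, hb⟩ := QuotientGroup.mk_surjective (Additive.toMul (kummerEquiv K 2 (W.twoTorsionCharH1 h.swap₁₂ c)))
  exact ⟨a, b, by rw [ha, ofMul_toMul], by rw [hb, ofMul_toMul]⟩

/-- **Components determine the class**: two classes with the same component pair are equal.
[cite: SilvermanAEC2009, Thm. X.1.1(c), Prop. X.1.4] -/
theorem eq_of_kummerEquiv_twoTorsionCharH1_pair_eq (h : W.toAffine.SplitTwoTorsion e₁ e₂ e₃) {c c' : galH1Torsion W 2}
    (a b : Kˣ) (ha : kummerEquiv K 2 (W.twoTorsionCharH1 h c) = Additive.ofMul (QuotientGroup.mk a))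
    (hb : kummerEquiv K 2 (W.twoTorsionCharH1 h.swap₁₂ c) = Additive.ofMul (QuotientGroup.mk b))
    (ha' : kummerEquiv K 2 (W.twoTorsionCharH1 h c') = Additive.ofMul (QuotientGroup.mk a))
    (hb' : kummerEquiv K 2 (W.twoTorsionCharH1 h.swap₁₂ c') = Additive.ofMul (QuotientGroup.mk b)) : c = c' := by
  rw [W.eq_twoDescentClass_of_kummerEquiv_eq h a b ha hb, W.eq_twoDescentClass_of_kummerEquiv_eq h a b ha' hb']

end Components

/-! ## §2 A twisting prime is an `I₀*` place of the twist: the relations -/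

section TwistingPrime

variable (W : WeierstrassCurve ℚ) [W.IsElliptic] {e₁ e₂ e₃ : ℚ} (h : W.toAffine.SplitTwoTorsion e₁ e₂ e₃)
variable {d : ℚ} [(W.quadraticTwist d).IsElliptic] {q : ℕ} [hq : Fact q.Prime]

/-- The root differences of the twist: `v_q(d eᵢ - d eⱼ) = 1` when `v_q(d) = 1` and `v_q(eᵢ - eⱼ) = 0`. [folklore] -/
private theorem padicValRat_twist_sub (hqd : padicValRat q d = 1) {e e' : ℚ} (hne : e ≠ e')
    (he : padicValRat q (e - e') = 0) : padicValRat q (d * e - d * e') = 1 := by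
  have hd0 : d ≠ 0 := by
    intro hd0; rw [hd0, padicValRat.zero] at hqd; exact zero_ne_one hqd
  rw [← mul_sub, padicValRat.mul hd0 (sub_ne_zero.mpr hne), hqd, he, add_zero]

/-- **The `I₀*` relations at a twisting prime.** Let `q` be an odd prime with `v_q(d) = 1` at which the root
differences of `E` are units. For `c ∈ Sel⁽²⁾(E^{(d)}/ℚ)` with components `([a], [b])` (roots `d e₁, d e₂, d e₃`):
`qr_q(a) = v_q(a)·(qr_q(d) + qr_q(e₂ - e₁)) + v_q(b)·qr_q((e₁ - e₂)(e₁ - e₃))` and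
`qr_q(b) = v_q(a)·qr_q((e₂ - e₁)(e₂ - e₃)) + v_q(b)·(qr_q(d) + qr_q(e₁ - e₂))` in `ℤ/2`.
[cite: SilvermanAEC2009, Prop. X.1.4, Prop. X.4.9] [cite: MazurRubin2010, Lemma 2.10, Lemma 2.11] -/
theorem qrBit_rel_quadraticTwist_of_mem_selmerGroup (hqd : padicValRat q d = 1)
    (h12 : padicValRat q (e₁ - e₂) = 0) (h13 : padicValRat q (e₁ - e₃) = 0) (h23 : padicValRat q (e₂ - e₃) = 0)
    {c : galH1Torsion (W.quadraticTwist d) 2} (hc : c ∈ selmerGroup (W.quadraticTwist d) 2) (a b : ℚˣ)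
    (ha : kummerEquiv ℚ 2 ((W.quadraticTwist d).twoTorsionCharH1 (h.quadraticTwist d) c) =
      Additive.ofMul (QuotientGroup.mk a))
    (hb : kummerEquiv ℚ 2 ((W.quadraticTwist d).twoTorsionCharH1 (h.quadraticTwist d).swap₁₂ c) =
      Additive.ofMul (QuotientGroup.mk b)) :
    qrBit q (a : ℚ) = parityBit q (a : ℚ) * (qrBit q d + qrBit q (e₂ - e₁)) +
        parityBit q (b : ℚ) * qrBit q ((e₁ - e₂) * (e₁ - e₃)) ∧
      qrBit q (b : ℚ) = parityBit q (a : ℚ) * qrBit q ((e₂ - e₁) * (e₂ - e₃)) +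
        parityBit q (b : ℚ) * (qrBit q d + qrBit q (e₁ - e₂)) := by
  have hd0 : d ≠ 0 := by
    intro hd0; rw [hd0, padicValRat.zero] at hqd; exact zero_ne_one hqd
  set v : HeightOneSpectrum (𝓞 ℚ) := primesEquiv.symm ⟨q, hq.out⟩ with hv
  have hqv : (primesEquiv v : ℕ) = q := by rw [hv, Equiv.apply_symm_apply]
  have h21 : padicValRat q (e₂ - e₁) = 0 := by rw [← neg_sub, padicValRat.neg, h12]
  have key := (W.quadraticTwist d).qrBit_eq_of_mem_selmerGroup_of_add (h.quadraticTwist d) hc v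
    (by rw [hqv]; exact padicValRat_twist_sub hqd h.ne₁₂ h12)
    (by rw [hqv]; exact padicValRat_twist_sub hqd h.ne₁₃ h13)
    (by rw [hqv]; exact padicValRat_twist_sub hqd h.ne₂₃ h23) a b ha hb
  simp only [hqv] at key
  have he12 : e₁ - e₂ ≠ 0 := sub_ne_zero.mpr h.ne₁₂
  have he21 : e₂ - e₁ ≠ 0 := sub_ne_zero.mpr h.ne₁₂.symm
  have he13 : e₁ - e₃ ≠ 0 := sub_ne_zero.mpr h.ne₁₃
  have he23 : e₂ - e₃ ≠ 0 := sub_ne_zero.mpr h.ne₂₃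
  have r1 : qrBit q (d * e₂ - d * e₁) = qrBit q d + qrBit q (e₂ - e₁) := by
    rw [← mul_sub, qrBit_mul q hd0 he21]
  have r2 : qrBit q ((d * e₁ - d * e₂) * (d * e₁ - d * e₃)) = qrBit q ((e₁ - e₂) * (e₁ - e₃)) := by
    rw [show (d * e₁ - d * e₂) * (d * e₁ - d * e₃) = d ^ 2 * ((e₁ - e₂) * (e₁ - e₃)) by ring,
      qrBit_mul q (pow_ne_zero 2 hd0) (mul_ne_zero he12 he13), qrBit_sq, zero_add]
  have r3 : qrBit q ((d * e₂ - d * e₁) * (d * e₂ - d * e₃)) = qrBit q ((e₂ - e₁) * (e₂ - e₃)) := by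
    rw [show (d * e₂ - d * e₁) * (d * e₂ - d * e₃) = d ^ 2 * ((e₂ - e₁) * (e₂ - e₃)) by ring,
      qrBit_mul q (pow_ne_zero 2 hd0) (mul_ne_zero he21 he23), qrBit_sq, zero_add]
  have r4 : qrBit q (d * e₁ - d * e₂) = qrBit q d + qrBit q (e₁ - e₂) := by
    rw [← mul_sub, qrBit_mul q hd0 he12]
  rw [r1, r2, r3, r4] at key
  exact key

/-- **At a twisting prime, a Selmer class with unit components is `q`-adically trivial**: if both
components of `c ∈ Sel⁽²⁾(E^{(d)}/ℚ)` have even valuation at `q`, their unit parts are squares mod `q`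
(`qr_q(a) = qr_q(b) = 0`). [cite: SilvermanAEC2009, Prop. X.1.4, Prop. X.4.9] [cite: MazurRubin2010, Lemma 2.11] -/
theorem qrBit_eq_zero_quadraticTwist_of_parityBit_eq_zero (hqd : padicValRat q d = 1)
    (h12 : padicValRat q (e₁ - e₂) = 0) (h13 : padicValRat q (e₁ - e₃) = 0) (h23 : padicValRat q (e₂ - e₃) = 0)
    {c : galH1Torsion (W.quadraticTwist d) 2} (hc : c ∈ selmerGroup (W.quadraticTwist d) 2) (a b : ℚˣ)
    (ha : kummerEquiv ℚ 2 ((W.quadraticTwist d).twoTorsionCharH1 (h.quadraticTwist d) c) =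
      Additive.ofMul (QuotientGroup.mk a))
    (hb : kummerEquiv ℚ 2 ((W.quadraticTwist d).twoTorsionCharH1 (h.quadraticTwist d).swap₁₂ c) =
      Additive.ofMul (QuotientGroup.mk b))
    (hpa : parityBit q (a : ℚ) = 0) (hpb : parityBit q (b : ℚ) = 0) :
    qrBit q (a : ℚ) = 0 ∧ qrBit q (b : ℚ) = 0 := by
  obtain ⟨r1, r2⟩ := W.qrBit_rel_quadraticTwist_of_mem_selmerGroup h hqd h12 h13 h23 hc a b ha hb
  rw [hpa, hpb, zero_mul, zero_mul, zero_add] at r1 r2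
  exact ⟨r1, r2⟩

/-! ## §3 Torsion normalisation at a twisting prime -/

/-- Parity of a product with a unit at `q`. [folklore] -/
private theorem parityBit_mul_eq (a : ℚˣ) {t : ℚ} (ht : t ≠ 0) :
    parityBit q ((a : ℚ) * t) = parityBit q (a : ℚ) + parityBit q t :=
  parityBit_mul a.ne_zero ht

/-- A bit of `ℤ/2` is `0` or `1`. [folklore] -/
private theorem zmod2_cases (x : ZMod 2) : x = 0 ∨ x = 1 := by revert x; decide

/-- **Torsion normalisation at a twisting prime.** For `q` odd with `v_q(d) = 1` and unit root differences,
and any `a, b ∈ ℚˣ`, one of the four torsion pairs `(t₁, t₂)` of `E^{(d)}` — `(1, 1)`,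
`(d²(e₁-e₂)(e₁-e₃), d(e₁-e₂))`, `(d(e₂-e₁), d²(e₂-e₁)(e₂-e₃))`, `(d(e₃-e₁), d(e₃-e₂))`, of `q`-parities
`(0,0), (0,1), (1,0), (1,1)` — makes `v_q(a t₁)` and `v_q(b t₂)` even; and its class `c(t₁, t₂)` lies in
`Sel⁽²⁾(E^{(d)}/ℚ)` (it is the Kummer image of a rational `2`-torsion point).
[cite: SilvermanAEC2009, Prop. X.1.4, Thm. X.4.2] [cite: MazurRubin2010, Lemma 2.10] -/
theorem exists_torsionPair_quadraticTwist_parityBit_mul_eq_zero (hqd : padicValRat q d = 1)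
    (h12 : padicValRat q (e₁ - e₂) = 0) (h13 : padicValRat q (e₁ - e₃) = 0) (h23 : padicValRat q (e₂ - e₃) = 0)
    (a b : ℚˣ) :
    ∃ t₁ t₂ : ℚˣ, (W.quadraticTwist d).twoDescentClass (h.quadraticTwist d) t₁ t₂ ∈ selmerGroup (W.quadraticTwist d) 2 ∧
      parityBit q ((a : ℚ) * t₁) = 0 ∧ parityBit q ((b : ℚ) * t₂) = 0 := by
  have hd0 : d ≠ 0 := by
    intro hd0; rw [hd0, padicValRat.zero] at hqd; exact zero_ne_one hqd
  have h' := h.quadraticTwist d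
  have he12 : e₁ - e₂ ≠ 0 := sub_ne_zero.mpr h.ne₁₂
  have he21 : e₂ - e₁ ≠ 0 := sub_ne_zero.mpr h.ne₁₂.symm
  have he13 : e₁ - e₃ ≠ 0 := sub_ne_zero.mpr h.ne₁₃
  have he31 : e₃ - e₁ ≠ 0 := sub_ne_zero.mpr h.ne₁₃.symm
  have he23 : e₂ - e₃ ≠ 0 := sub_ne_zero.mpr h.ne₂₃
  have he32 : e₃ - e₂ ≠ 0 := sub_ne_zero.mpr h.ne₂₃.symm
  have h21 : padicValRat q (e₂ - e₁) = 0 := by rw [← neg_sub, padicValRat.neg, h12]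
  have h31 : padicValRat q (e₃ - e₁) = 0 := by rw [← neg_sub, padicValRat.neg, h13]
  have h32 : padicValRat q (e₃ - e₂) = 0 := by rw [← neg_sub, padicValRat.neg, h23]
  -- the torsion values of the twist and their parities
  have hT1a : (d * e₁ - d * e₂) * (d * e₁ - d * e₃) = d ^ 2 * ((e₁ - e₂) * (e₁ - e₃)) := by ring
  have hT1b : d * e₁ - d * e₂ = d * (e₁ - e₂) := by ring
  have hT2a : d * e₂ - d * e₁ = d * (e₂ - e₁) := by ring
  have hT2b : (d * e₂ - d * e₁) * (d * e₂ - d * e₃) = d ^ 2 * ((e₂ - e₁) * (e₂ - e₃)) := by ring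
  have hT3a : d * e₃ - d * e₁ = d * (e₃ - e₁) := by ring
  have hT3b : d * e₃ - d * e₂ = d * (e₃ - e₂) := by ring
  have hp2 : ∀ {t : ℚ} (ht : t ≠ 0), padicValRat q t = 0 → parityBit q (d ^ 2 * t) = 0 := by
    intro t ht h0
    rw [parityBit, padicValRat.mul (pow_ne_zero 2 hd0) ht, padicValRat.pow d, hqd, h0]
    decide
  have hp1 : ∀ {t : ℚ} (ht : t ≠ 0), padicValRat q t = 0 → parityBit q (d * t) = 1 := by
    intro t ht h0
    rw [parityBit, padicValRat.mul hd0 ht, hqd, h0]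
    decide
  -- the four cases on the parities of `a`, `b`
  rcases zmod2_cases (parityBit q (a : ℚ)) with ha | ha <;> rcases zmod2_cases (parityBit q (b : ℚ)) with hb | hb
  · -- `(0,0)`: the pair `(1,1)` of `O`
    refine ⟨1, 1, ?_, by rw [Units.val_one, mul_one, ha], by rw [Units.val_one, mul_one, hb]⟩
    rw [mem_selmerGroup_iff]
    refine ⟨fun v => ?_, fun w => ?_⟩
    · exact twoDescentClass_mem_selmerLocalKer_of_isSquare (W.quadraticTwist d) h' _
        (charZero_of_injective_algebraMap (algebraMap ℚ _).injective) 1 1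
        ⟨1, by rw [Units.val_one, map_one, mul_one]⟩ ⟨1, by rw [Units.val_one, map_one, mul_one]⟩
    · exact twoDescentClass_mem_selmerLocalKer_of_isSquare (W.quadraticTwist d) h' _
        (charZero_of_injective_algebraMap (algebraMap ℚ _).injective) 1 1
        ⟨1, by rw [Units.val_one, map_one, mul_one]⟩ ⟨1, by rw [Units.val_one, map_one, mul_one]⟩
  · -- `(0,1)`: the pair of `T₁`
    have hv1 : (d * e₁ - d * e₂) * (d * e₁ - d * e₃) ≠ 0 := by
      rw [hT1a]; exact mul_ne_zero (pow_ne_zero 2 hd0) (mul_ne_zero he12 he13)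
    have hv2 : d * e₁ - d * e₂ ≠ 0 := by rw [hT1b]; exact mul_ne_zero hd0 he12
    refine ⟨Units.mk0 _ hv1, Units.mk0 _ hv2, twoDescentClass_mem_selmerGroup_T₁ (W.quadraticTwist d) h' _ _ rfl rfl, ?_, ?_⟩
    · rw [Units.val_mk0, parityBit_mul_eq a hv1, ha, hT1a, hp2 (mul_ne_zero he12 he13)
        (by rw [padicValRat.mul he12 he13, h12, h13, add_zero]), add_zero]
    · rw [Units.val_mk0, parityBit_mul_eq b hv2, hb, hT1b, hp1 he12 h12]; decide
  · -- `(1,0)`: the pair of `T₂`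
    have hv1 : d * e₂ - d * e₁ ≠ 0 := by rw [hT2a]; exact mul_ne_zero hd0 he21
    have hv2 : (d * e₂ - d * e₁) * (d * e₂ - d * e₃) ≠ 0 := by
      rw [hT2b]; exact mul_ne_zero (pow_ne_zero 2 hd0) (mul_ne_zero he21 he23)
    refine ⟨Units.mk0 _ hv1, Units.mk0 _ hv2, twoDescentClass_mem_selmerGroup_T₂ (W.quadraticTwist d) h' _ _ rfl rfl, ?_, ?_⟩
    · rw [Units.val_mk0, parityBit_mul_eq a hv1, ha, hT2a, hp1 he21 h21]; decide
    · rw [Units.val_mk0, parityBit_mul_eq b hv2, hb, hT2b, hp2 (mul_ne_zero he21 he23)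
        (by rw [padicValRat.mul he21 he23, h21, h23, add_zero]), add_zero]
  · -- `(1,1)`: the pair of `T₃`
    have hv1 : d * e₃ - d * e₁ ≠ 0 := by rw [hT3a]; exact mul_ne_zero hd0 he31
    have hv2 : d * e₃ - d * e₂ ≠ 0 := by rw [hT3b]; exact mul_ne_zero hd0 he32
    refine ⟨Units.mk0 _ hv1, Units.mk0 _ hv2, twoDescentClass_mem_selmerGroup_T₃ (W.quadraticTwist d) h' _ _ rfl rfl, ?_, ?_⟩
    · rw [Units.val_mk0, parityBit_mul_eq a hv1, ha, hT3a, hp1 he31 h31]; decide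
    · rw [Units.val_mk0, parityBit_mul_eq b hv2, hb, hT3b, hp1 he32 h32]; decide

/-- **Normalised form of a Selmer class at a twisting prime.** Every `c ∈ Sel⁽²⁾(E^{(d)}/ℚ)` with
components `([a], [b])` is `c' - c(t₁, t₂)` for a torsion pair `(t₁, t₂)` and a class `c' ∈ Sel⁽²⁾(E^{(d)}/ℚ)`
with components `([a t₁], [b t₂])` that are `q`-ADIC SQUARES (`v_q` even and unit part a residue).
[cite: SilvermanAEC2009, Prop. X.1.4, Prop. X.4.9] [cite: MazurRubin2010, Lemma 2.10, Lemma 2.11] -/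
theorem exists_add_torsionPair_quadraticTwist_trivial_at (hqd : padicValRat q d = 1)
    (h12 : padicValRat q (e₁ - e₂) = 0) (h13 : padicValRat q (e₁ - e₃) = 0) (h23 : padicValRat q (e₂ - e₃) = 0)
    {c : galH1Torsion (W.quadraticTwist d) 2} (hc : c ∈ selmerGroup (W.quadraticTwist d) 2) (a b : ℚˣ)
    (ha : kummerEquiv ℚ 2 ((W.quadraticTwist d).twoTorsionCharH1 (h.quadraticTwist d) c) =
      Additive.ofMul (QuotientGroup.mk a))
    (hb : kummerEquiv ℚ 2 ((W.quadraticTwist d).twoTorsionCharH1 (h.quadraticTwist d).swap₁₂ c) =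
      Additive.ofMul (QuotientGroup.mk b)) :
    ∃ t₁ t₂ : ℚˣ, (W.quadraticTwist d).twoDescentClass (h.quadraticTwist d) t₁ t₂ ∈ selmerGroup (W.quadraticTwist d) 2 ∧
      c + (W.quadraticTwist d).twoDescentClass (h.quadraticTwist d) t₁ t₂ ∈ selmerGroup (W.quadraticTwist d) 2 ∧
      kummerEquiv ℚ 2 ((W.quadraticTwist d).twoTorsionCharH1 (h.quadraticTwist d)
          (c + (W.quadraticTwist d).twoDescentClass (h.quadraticTwist d) t₁ t₂)) =
        Additive.ofMul (QuotientGroup.mk (a * t₁)) ∧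
      kummerEquiv ℚ 2 ((W.quadraticTwist d).twoTorsionCharH1 (h.quadraticTwist d).swap₁₂
          (c + (W.quadraticTwist d).twoDescentClass (h.quadraticTwist d) t₁ t₂)) =
        Additive.ofMul (QuotientGroup.mk (b * t₂)) ∧
      parityBit q ((a : ℚ) * t₁) = 0 ∧ parityBit q ((b : ℚ) * t₂) = 0 ∧
      qrBit q ((a : ℚ) * t₁) = 0 ∧ qrBit q ((b : ℚ) * t₂) = 0 := by
  obtain ⟨t₁, t₂, ht, hpa, hpb⟩ :=
    W.exists_torsionPair_quadraticTwist_parityBit_mul_eq_zero h hqd h12 h13 h23 a b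
  have h' := h.quadraticTwist d
  have hc' : c + (W.quadraticTwist d).twoDescentClass h' t₁ t₂ ∈ selmerGroup (W.quadraticTwist d) 2 := add_mem hc ht
  have ha' := (W.quadraticTwist d).kummerEquiv_twoTorsionCharH1_add h' a t₁ ha
    ((W.quadraticTwist d).kummerEquiv_twoTorsionCharH1_twoDescentClass h' t₁ t₂)
  have hb' := (W.quadraticTwist d).kummerEquiv_twoTorsionCharH1_add h'.swap₁₂ b t₂ hb
    ((W.quadraticTwist d).kummerEquiv_twoTorsionCharH1_swap_twoDescentClass h' t₁ t₂)
  have hq0 := W.qrBit_eq_zero_quadraticTwist_of_parityBit_eq_zero h hqd h12 h13 h23 hc' (a * t₁) (b * t₂)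
    ha' hb' (by rw [Units.val_mul]; exact hpa) (by rw [Units.val_mul]; exact hpb)
  rw [Units.val_mul, Units.val_mul] at hq0
  exact ⟨t₁, t₂, ht, hc', ha', hb', hpa, hpb, hq0.1, hq0.2⟩

end TwistingPrime

/-! ## §4 The real place when the roots decrease: both components have the same sign -/

section RealPlace

/-- **The real condition for decreasing roots, over a linearly ordered field**: on
`z² = (X - e₁)(X - e₂)(X - e₃)` with `e₁ > e₂ > e₃` and `X ≠ e₁, e₂`, the factors `X - e₁` and `X - e₂` have
the same sign, `0 < (X - e₁)(X - e₂)` (if `e₂ < X < e₁` the product of the three factors is negative).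
[cite: SilvermanAEC2009, Prop. X.1.4] -/
theorem _root_.Literature.NumberTheory.EllipticCurves.TwoDescentLocal.mul_sub_pos_of_sq_eq_mul_mul_of_gt
    {L : Type*} [Field L] [LinearOrder L] [IsStrictOrderedRing L]
    {e₁ e₂ e₃ X z : L} (h12 : e₂ < e₁) (h23 : e₃ < e₂) (hX₁ : X ≠ e₁) (hX₂ : X ≠ e₂)
    (h : z ^ 2 = (X - e₁) * (X - e₂) * (X - e₃)) : 0 < (X - e₁) * (X - e₂) := by
  rcases lt_or_gt_of_ne (sub_ne_zero.mpr hX₁) with h1 | h1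
  · rcases lt_or_gt_of_ne (sub_ne_zero.mpr hX₂) with h2 | h2
    · exact mul_pos_of_neg_of_neg h1 h2
    · exfalso
      have h3 : 0 < X - e₃ := by linarith
      have hprod : (X - e₁) * (X - e₂) * (X - e₃) < 0 := mul_neg_of_neg_of_pos (mul_neg_of_neg_of_pos h1 h2) h3
      have hz : 0 ≤ z ^ 2 := sq_nonneg z
      rw [h] at hz
      exact absurd hprod (not_lt.mpr hz)
  · have h2 : 0 < X - e₂ := by linarith
    exact mul_pos h1 h2

variable (W : WeierstrassCurve ℚ) [W.IsElliptic] {e₁ e₂ e₃ : ℚ}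

omit [W.IsElliptic] in
/-- **On `E(ℚ_∞)` with decreasing roots the product of the two descent components is positive**: for an
infinite place `w` and `P ∈ E(ℚ_w)` whose components are the classes of `algebraMap a`, `algebraMap b`
(`a, b ∈ ℚˣ`), `0 < a b`. [cite: SilvermanAEC2009, Prop. X.1.4] -/
theorem mul_pos_of_twoDescentComponent_pair_eq_infinitePlace (h : W.toAffine.SplitTwoTorsion e₁ e₂ e₃)
    (h12 : e₂ < e₁) (h23 : e₃ < e₂) (w : InfinitePlace ℚ) (hw : w.IsReal) [(W.baseChange w.Completion).IsElliptic]
    (P : (W.baseChange w.Completion).toAffine.Point) (a b : ℚˣ)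
    (hPa : Affine.Point.twoDescentComponent (W.baseChange w.Completion).toAffine
        (algebraMap ℚ w.Completion e₁) (algebraMap ℚ w.Completion e₂) (algebraMap ℚ w.Completion e₃) P =
      QuotientGroup.mk (Units.map (algebraMap ℚ w.Completion : ℚ →* w.Completion) a))
    (hPb : Affine.Point.twoDescentComponent (W.baseChange w.Completion).toAffine
        (algebraMap ℚ w.Completion e₂) (algebraMap ℚ w.Completion e₁) (algebraMap ℚ w.Completion e₃) P =
      QuotientGroup.mk (Units.map (algebraMap ℚ w.Completion : ℚ →* w.Completion) b)) :
    0 < (a : ℚ) * b := by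
  set ι := algebraMap ℚ w.Completion with hι
  set φ := InfinitePlace.Completion.ringEquivRealOfIsReal hw with hφ
  have hφι : ∀ r : ℚ, φ (ι r) = (r : ℝ) := ringEquivRealOfIsReal_algebraMap w hw
  have hφu : ∀ u : ℚˣ, φ ((Units.map (ι : ℚ →* w.Completion) u : w.Completionˣ) : w.Completion) = (u : ℝ) := fun u => by
    rw [Units.coe_map, MonoidHom.coe_coe]; exact hφι u
  -- it suffices to exhibit `r, r'` with `φ (r r') > 0` representing the two components
  suffices key : ∃ r r' : w.Completion, r ≠ 0 ∧ r' ≠ 0 ∧ 0 < φ r * φ r' ∧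
      Affine.Point.twoDescentComponent (W.baseChange w.Completion).toAffine (ι e₁) (ι e₂) (ι e₃) P = sqClass r ∧
      Affine.Point.twoDescentComponent (W.baseChange w.Completion).toAffine (ι e₂) (ι e₁) (ι e₃) P = sqClass r' by
    obtain ⟨r, r', hr0, hr0', hpos, hPr, hPr'⟩ := key
    obtain ⟨s, hs0, hrs⟩ := exists_eq_mul_sq_of_mk_eq_sqClass hr0 (hPa.symm.trans hPr)
    obtain ⟨s', hs0', hrs'⟩ := exists_eq_mul_sq_of_mk_eq_sqClass hr0' (hPb.symm.trans hPr')
    have hreal : φ r * φ r' = ((a : ℚ) * b : ℝ) * (φ s * φ s') ^ 2 := by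
      rw [hrs, hrs', map_mul, map_mul, map_pow, map_pow, hφu, hφu]; ring
    have hs2 : 0 < (φ s * φ s') ^ 2 := by
      have : φ s ≠ 0 := (map_ne_zero_iff φ φ.injective).mpr hs0
      have : φ s' ≠ 0 := (map_ne_zero_iff φ φ.injective).mpr hs0'
      positivity
    have : 0 < ((a : ℚ) * b : ℝ) := by
      by_contra hle
      have hle' : ((a : ℚ) * b : ℝ) ≤ 0 := not_lt.mp hle
      have : φ r * φ r' ≤ 0 := by rw [hreal]; exact mul_nonpos_of_nonpos_of_nonneg hle' hs2.le
      linarith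
    exact_mod_cast this
  have hsplit := h.map w.Completion
  rcases P with _ | ⟨x, y, hxy⟩
  · refine ⟨1, 1, one_ne_zero, one_ne_zero, by rw [map_one, mul_one]; exact one_pos, ?_, ?_⟩
    · rw [← zero_def, twoDescentComponent_zero, ← mul_one (1 : w.Completion), sqClass_mul_self]
    · rw [← zero_def, twoDescentComponent_zero, ← mul_one (1 : w.Completion), sqClass_mul_self]
  have h1 : (e₂ : ℝ) < e₁ := by exact_mod_cast h12
  have h2 : (e₃ : ℝ) < e₂ := by exact_mod_cast h23
  by_cases hx₁ : x = ι e₁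
  · -- `T₁`: components `((e₁-e₂)(e₁-e₃), e₁-e₂)`, both positive
    refine ⟨(ι e₁ - ι e₂) * (ι e₁ - ι e₃), ι e₁ - ι e₂, hsplit.c_ne_zero, sub_ne_zero.mpr hsplit.ne₁₂, ?_,
      twoDescentComponent_some_of_eq hxy hx₁, ?_⟩
    · simp only [map_mul, map_sub, hφι]
      have : (0 : ℝ) < e₁ - e₂ := by linarith
      have : (0 : ℝ) < e₁ - e₃ := by linarith
      positivity
    · rw [twoDescentComponent_some_of_ne hxy (by rw [hx₁]; exact hsplit.ne₁₂), hx₁]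
  by_cases hx₂ : x = ι e₂
  · -- `T₂`: components `(e₂-e₁, (e₂-e₁)(e₂-e₃))`, both negative
    refine ⟨ι e₂ - ι e₁, (ι e₂ - ι e₁) * (ι e₂ - ι e₃), sub_ne_zero.mpr hsplit.ne₁₂.symm, hsplit.swap₁₂.c_ne_zero, ?_,
      ?_, twoDescentComponent_some_of_eq hxy hx₂⟩
    · simp only [map_mul, map_sub, hφι]
      have ha' : (e₂ : ℝ) - e₁ < 0 := by linarith
      have hb' : ((e₂ : ℝ) - e₁) * (e₂ - e₃) < 0 := mul_neg_of_neg_of_pos ha' (by linarith)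
      exact mul_pos_of_neg_of_neg ha' hb'
    · rw [twoDescentComponent_some_of_ne hxy hx₁, hx₂]
  · -- a point with `x ≠ e₁, e₂`
    refine ⟨x - ι e₁, x - ι e₂, sub_ne_zero.mpr hx₁, sub_ne_zero.mpr hx₂, ?_,
      twoDescentComponent_some_of_ne hxy hx₁, twoDescentComponent_some_of_ne hxy hx₂⟩
    -- `CharZero ℚ_w` only now: an earlier instance would re-route `algebraMap ℚ ℚ_w` through `Rat.cast`
    haveI : CharZero w.Completion := charZero_of_injective_algebraMap ι.injective
    have hsq := sq_eq_mul_mul_of_equation hsplit hxy.1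
    have hsqR := congrArg φ hsq
    rw [map_pow, map_mul, map_mul, map_sub, map_sub, map_sub, hφι, hφι, hφι] at hsqR
    have hX₁ : φ x ≠ (e₁ : ℝ) := by
      intro hX; apply hx₁; apply φ.injective; rw [hX, hφι]
    have hX₂ : φ x ≠ (e₂ : ℝ) := by
      intro hX; apply hx₂; apply φ.injective; rw [hX, hφι]
    rw [map_sub, map_sub, hφι, hφι]
    exact mul_sub_pos_of_sq_eq_mul_mul_of_gt h1 h2 hX₁ hX₂ hsqR

/-- **Selmer classes have components of the same sign when the roots decrease** (Silverman AEC Prop. X.1.4 /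
X.4.9 at the real place, for `e₁ > e₂ > e₃` — e.g. the twist by a NEGATIVE `d` of a curve with increasing roots):
for `c ∈ Sel⁽²⁾(E/ℚ)` with components `([a], [b])`, `0 < a b`: the real image is `{(+,+), (−,−)}`.
[cite: SilvermanAEC2009, Prop. X.1.4, Prop. X.4.9] [cite: Kramer1981, Prop. 3] -/
theorem mul_pos_of_mem_selmerGroup_of_gt (h : W.toAffine.SplitTwoTorsion e₁ e₂ e₃) (h12 : e₂ < e₁) (h23 : e₃ < e₂)
    {c : galH1Torsion W 2} (hc : c ∈ selmerGroup W 2) (a b : ℚˣ)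
    (ha : kummerEquiv ℚ 2 (W.twoTorsionCharH1 h c) = Additive.ofMul (QuotientGroup.mk a))
    (hb : kummerEquiv ℚ 2 (W.twoTorsionCharH1 h.swap₁₂ c) = Additive.ofMul (QuotientGroup.mk b)) :
    0 < (a : ℚ) * b := by
  let w : InfinitePlace ℚ := Rat.infinitePlace
  haveI : (W.baseChange w.Completion).IsElliptic := W.isElliptic_baseChange _
  haveI : (W.baseChange (Place.Completion (Sum.inl w : Place ℚ))).IsElliptic := W.isElliptic_baseChange _
  haveI : CharZero (Place.Completion (Sum.inl w : Place ℚ)) :=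
    charZero_of_injective_algebraMap (algebraMap ℚ w.Completion).injective
  obtain ⟨P, hPa, hPb⟩ := W.exists_twoDescentComponent_pair_eq_of_mem_selmerGroup h hc (Sum.inl w : Place ℚ) a b ha hb
  exact W.mul_pos_of_twoDescentComponent_pair_eq_infinitePlace h h12 h23 w Rat.isReal_infinitePlace P a b hPa hPb

end RealPlace

end WeierstrassCurve

end
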